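/-
Copyright (c) 2026 the pub-hodgecm-mathlib formalisation cell (harness21).  Prover seat hodgecm-mathlib-F0P2-p10 (g3), Track B «K2-LIT»,
#184♮ = hLiu418 = `stmt-HodgeConjecture-24832`; FACE-D₀ `h2₂` chain of K2Liu-p02 (g9) (chain-desk deal 2026-09-05T01:23:26Z, LEAD F0P6-plan (g15) BATCH #230:
on the #42F′ tie clock).  THEOREMS ONLY (no `def`, no `instance`, no notation, no named-fact hypothesis, no `sorry`).
-/
import Summits.HodgeConjecture.HodgeConjecture.Theorems.K2LiuSiegelUnipotentFourierDefs          -- ★ `skewMatrices`, `mem_skewMatrices_iff`, `gramR`, `imagUnit`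
import Literature.NumberTheory.GelbartRogawski1991.DoubledWeilRepresentationLocalFamilyCM       -- ★ `gramR_isSymm`
import HarnessLib

/-!
# Crux `HLiu418`, FACE-D₀ `h2₂` — `K2LiuHermitianSkewDictionary`: THE INDEX DICTIONARY `β ↦ δ · T⁻¹ β` BETWEEN HERMITIAN `β` (the FACE-D₀ rows)
# AND `T`-SKEW `S` (the Fourier machinery), its determinant, and the `hS` clause of ★ `K2LiuFirstTermHolCutRows.exists_rows_of_mem` VERBATIM

Cell `hodgecm-mathlib`, crux item hLiu418 = `stmt-HodgeConjecture-24832` (helper lane `--supports … --as helper`, count-neutral), route of record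
`HCCMUnconditional`; squad K2 ∕ K2Liu; prover F0P2-p10 (g3); consumers: the FACE-D₀ assembler's `dict`∕`hS` input (★ `K2LiuFirstTermHolCutRows` :120–:121)
and K2Liu-p02's `h2Row_at_place ∘ dict`.

THE MATHEMATICS.  `c` = complex conjugation of the CM field `L`, `δ := imagUnit L` (`c δ = −δ ≠ 0`), `T := gramR ⊗ L` (REAL: `T.map c = T`, SYMMETRIC,
`det T` a unit).  Hermitian `β` (`(β^c)ᵀ = β`) ↦ `T`-skew `S` (`T S + (S^c)ᵀ T = 0`, ★ `skewMatrices`): the docstring dictionary `T⁻¹β` is of `T`-HERMITIAN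
type and is killed by `ψ_S`; the consistent dictionary carries the imaginary unit — **`dict β := δ • (T⁻¹ * reindex ρ⁻¹ ρ⁻¹ β)`** (`ρ : Fin n ≃ Fin 2`) —
with inverse `S ↦ reindex ρ ρ (δ⁻¹ • (T * S))` (K2E3-p23's `βloc := reindex ρ ρ (δ⁻¹ • (T_v S_v))` is its localisation).
* §1 (generic field `K`, involution-free: any ring hom `σ`, `σ δ = −δ`, `T^σ = T = Tᵀ`, `det T` unit) `smul_inv_mul_mem_skewMatrices` (hermitian ↦ skew),
  `transpose_map_smul_mul_of_mem_skewMatrices` (skew ↦ hermitian), `smul_inv_mul_smul_mul` (`δ • (T⁻¹ * (δ⁻¹ • (T * S))) = S`), `det_smul_inv_mul_ne_zero`.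
* §2 (the CM instance, `dict` as the explicit lambda) **`dict_mem_skewMatrices`**, **`det_dict_ne_zero`**, `dict_reindex_smul_mul` (`dict (ρ ∘ (δ⁻¹ • T S)) = S`),
  `transpose_map_reindex_smul_mul` (that `β` is hermitian), **`hS_dict`** = ★ HolCutRows' `hS` clause :120–:121 VERBATIM at this `dict`, `dict_eq_zero_iff` (injective).
[Shimura1997, §18.1 (18.4)] [KudlaRallis1994, §3] [MoeglinWaldspurger1995, I.2.6].
HONEST LABEL.  Count-neutral helper, closes no socket by itself; `h2₂` NOT discharged here: `HC_CM` is proved only modulo the 7 printed citations (2 remaining named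
inputs: hLiu418 = `stmt-HodgeConjecture-24832`, h413 = `stmt-HodgeConjecture-24833`) until rung 0 closes.

## References
* [Shimura1997] G. Shimura, *Euler Products and Eisenstein Series*, CBMS 93 (1997): §18.1 (18.4).
* [KudlaRallis1994] S. Kudla, S. Rallis, Ann. of Math. 140 (1994): §3.   * [MoeglinWaldspurger1995] C. Mœglin, J.-L. Waldspurger, *Spectral Decomposition and Eisenstein Series* (1995): I.2.6.
-/

set_option autoImplicit false
set_option linter.dupNamespace false -- the mandated namespace repeats `HodgeConjecture.HodgeConjecture`

noncomputable section

open scoped Matrix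
open NumberField IsDedekindDomain
open Literature.NumberTheory.Automorphic Literature.NumberTheory.Automorphic.UnitaryGroup
open Literature.NumberTheory.GelbartRogawski1991 Literature.NumberTheory.GelbartRogawski1991.GRConstruction
open Literature.NumberTheory.GelbartRogawski1991.UnitaryDualPair (imagUnit complexConj_imagUnit imagUnit_ne_zero isUnit_det_gram isUnit_det_realDiagonal)
open Literature.NumberTheory.K2Lit.SiegelDoubled
open Summit.HodgeConjecture.HodgeConjecture.Cruxes.HLiu418.K2LiuSiegelUnipotentFourierDefs

namespace Summit.HodgeConjecture.HodgeConjecture.Cruxes.HLiu418.K2LiuHermitianSkewDictionary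

/-! ## §1 Generic algebra: a real symmetric invertible `T`, an element `δ` with `σ δ = −δ` -/

section Generic

variable {K : Type*} [Field K] {ι : Type*} [Fintype ι] [DecidableEq ι] (σ : K →+* K)
  {T : Matrix ι ι K} (hTs : T.IsSymm) (hTσ : T.map σ = T) (hT : IsUnit T.det) {δ : K} (hδ : σ δ = -δ)

include hTσ hT in
/-- `(T⁻¹ M)^σ = T⁻¹ M^σ` for a `σ`-real invertible `T`. [folklore] -/
theorem map_inv_mul (M : Matrix ι ι K) : (T⁻¹ * M).map σ = T⁻¹ * M.map σ := by
  have h : T * (T⁻¹ * M).map σ = M.map σ := by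
    calc T * (T⁻¹ * M).map σ = T.map σ * (T⁻¹ * M).map σ := by rw [hTσ]
      _ = (T * (T⁻¹ * M)).map σ := Matrix.map_mul.symm
      _ = M.map σ := by rw [← Matrix.mul_assoc, Matrix.mul_nonsing_inv _ hT, Matrix.one_mul]
  rw [← h, ← Matrix.mul_assoc, Matrix.nonsing_inv_mul _ hT, Matrix.one_mul]

include hTs hTσ hT hδ in
/-- **hermitian ↦ skew**: `(β^σ)ᵀ = β ⇒ δ • (T⁻¹ β) ∈ Skew_T` (`T (δT⁻¹β) = δβ`, `((δT⁻¹β)^σ)ᵀ T = −δ βᵀ… = −δ β`). [cite: Shimura1997, §18.1 (18.4)] -/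
theorem smul_inv_mul_mem_skewMatrices (β : Matrix ι ι K) (hβ : (β.map σ)ᵀ = β) : δ • (T⁻¹ * β) ∈ skewMatrices σ T := by
  rw [mem_skewMatrices_iff]
  have h1 : T * (δ • (T⁻¹ * β)) = δ • β := by
    rw [Matrix.mul_smul, ← Matrix.mul_assoc, Matrix.mul_nonsing_inv _ hT, Matrix.one_mul]
  have h2 : ((δ • (T⁻¹ * β)).map σ)ᵀ * T = -(δ • β) := by
    rw [Matrix.map_smul' σ δ _ (map_mul σ), hδ, map_inv_mul σ hTσ hT, Matrix.transpose_smul, Matrix.transpose_mul, hβ,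
      Matrix.transpose_nonsing_inv, hTs.eq, Matrix.smul_mul, Matrix.mul_assoc, Matrix.nonsing_inv_mul _ hT, Matrix.mul_one, neg_smul]
  rw [h1, h2, add_neg_cancel]

omit [DecidableEq ι] in
include hTs hTσ hδ in
/-- **skew ↦ hermitian**: `S ∈ Skew_T ⇒ δ⁻¹ • (T S)` is `σ`-hermitian (`((T S)^σ)ᵀ = (S^σ)ᵀ T = −T S`, `σ δ⁻¹ = −δ⁻¹`). [cite: Shimura1997, §18.1 (18.4)] -/
theorem transpose_map_smul_mul_of_mem_skewMatrices (S : Matrix ι ι K) (hS : S ∈ skewMatrices σ T) :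
    ((δ⁻¹ • (T * S)).map σ)ᵀ = δ⁻¹ • (T * S) := by
  rw [mem_skewMatrices_iff] at hS
  have hST : (S.map σ)ᵀ * T = -(T * S) := eq_neg_of_add_eq_zero_right hS
  rw [Matrix.map_smul' σ δ⁻¹ _ (map_mul σ), map_inv₀, hδ, Matrix.transpose_smul, Matrix.map_mul, Matrix.transpose_mul, hTσ, hTs.eq, hST,
    inv_neg, smul_neg, neg_smul, neg_neg]

include hT in
/-- **the inverse dictionary**: `δ • (T⁻¹ * (δ⁻¹ • (T * S))) = S` (`δ ≠ 0`). [folklore] -/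
theorem smul_inv_mul_smul_mul (hδ0 : δ ≠ 0) (S : Matrix ι ι K) : δ • (T⁻¹ * (δ⁻¹ • (T * S))) = S := by
  rw [Matrix.mul_smul, smul_smul, mul_inv_cancel₀ hδ0, one_smul, ← Matrix.mul_assoc, Matrix.nonsing_inv_mul _ hT, Matrix.one_mul]

include hT in
/-- `T * (δ⁻¹ • … )` form of the same: `δ⁻¹ • (T * (δ • (T⁻¹ * β))) = β`. [folklore] -/
theorem inv_smul_mul_smul_inv_mul (hδ0 : δ ≠ 0) (β : Matrix ι ι K) : δ⁻¹ • (T * (δ • (T⁻¹ * β))) = β := by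
  rw [Matrix.mul_smul, smul_smul, inv_mul_cancel₀ hδ0, one_smul, ← Matrix.mul_assoc, Matrix.mul_nonsing_inv _ hT, Matrix.one_mul]

include hT in
/-- **determinant**: `det β ≠ 0 ⇒ det (δ • (T⁻¹ β)) ≠ 0` (`= δ^{#ι} (det T)⁻¹ det β`). [folklore] -/
theorem det_smul_inv_mul_ne_zero (hδ0 : δ ≠ 0) (β : Matrix ι ι K) (hβ : β.det ≠ 0) : (δ • (T⁻¹ * β)).det ≠ 0 := by
  rw [Matrix.det_smul, Matrix.det_mul]
  exact mul_ne_zero (pow_ne_zero _ hδ0) (mul_ne_zero (Matrix.isUnit_nonsing_inv_det T hT).ne_zero hβ)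

include hT in
/-- **injectivity**: `δ • (T⁻¹ β) = 0 ⇒ β = 0` (`δ ≠ 0`). [folklore] -/
theorem eq_zero_of_smul_inv_mul_eq_zero (hδ0 : δ ≠ 0) (β : Matrix ι ι K) (h : δ • (T⁻¹ * β) = 0) : β = 0 := by
  rw [← inv_smul_mul_smul_inv_mul hT hδ0 β, h, Matrix.mul_zero, smul_zero]

/-- reindexing commutes with `map` and transposition: `((ρ·M)^f)ᵀ = ρ·((M^f)ᵀ)`. [folklore] -/
theorem transpose_map_reindex {α β : Type*} {m m' : Type*} (ρ : m ≃ m') (f : α → β) (M : Matrix m m α) :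
    ((Matrix.reindex ρ ρ M).map f)ᵀ = Matrix.reindex ρ ρ ((M.map f)ᵀ) := by
  ext i j; rfl

/-- `reindex` of `0` is `0`, stated at square shape (entrywise `rfl`). [folklore] -/
theorem reindex_zero_sq {α : Type*} [Zero α] {m m' : Type*} (ρ : m ≃ m') : Matrix.reindex ρ ρ (0 : Matrix m m α) = 0 :=
  Matrix.ext fun _ _ => rfl

end Generic

/-! ## §2 The CM instance: `T := gramR ⊗ L`, `δ := imagUnit L`, `dict β := δ • (T⁻¹ * reindex ρ⁻¹ ρ⁻¹ β)` -/

variable (L : Type) [Field L] [NumberField L] [IsCMField L]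
variable {N M n : ℕ} (e : Fin N × Fin M ≃ Fin n)
  (dV : Fin N → L) (hdV : ∀ i, IsCMField.complexConj L (dV i) = dV i)
  (dW : Fin M → L) (hdW : ∀ i, IsCMField.complexConj L (dW i) = dW i)

/-- `T ⊗ L` is real: `(T ⊗ L)^c = T ⊗ L` (`c` is `L⁺`-linear). [folklore] -/
theorem map_gramRL_complexConj :
    ((gramR L e dV hdV dW hdW).map (algebraMap (Fp L) L)).map ((IsCMField.complexConj L : L ≃ₐ[Fp L] L) : L →+* L) =
      (gramR L e dV hdV dW hdW).map (algebraMap (Fp L) L) := by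
  rw [Matrix.map_map]
  exact congrArg (gramR L e dV hdV dW hdW).map (funext fun x => (IsCMField.complexConj L : L ≃ₐ[Fp L] L).commutes x)

/-- `T ⊗ L` is symmetric (★ `gramR_isSymm`). [cite: GelbartRogawski1991, §3.1 Prop. 3.1.1 p. 455] -/
theorem gramRL_isSymm : ((gramR L e dV hdV dW hdW).map (algebraMap (Fp L) L)).IsSymm :=
  (gramR_isSymm L e dV hdV dW hdW).map _

/-- `det (T ⊗ L)` is a unit when no `dV i`, `dW i` vanishes (★ `isUnit_det_gram`, ★ `isUnit_det_realDiagonal`). [cite: GelbartRogawski1991, §3.1 Prop. 3.1.1 p. 455] -/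
theorem isUnit_det_gramRL (hdV0 : ∀ i, dV i ≠ 0) (hdW0 : ∀ i, dW i ≠ 0) : IsUnit ((gramR L e dV hdV dW hdW).map (algebraMap (Fp L) L)).det := by
  have h : IsUnit (gramR L e dV hdV dW hdW).det := by
    unfold gramR
    exact isUnit_det_gram (Fp L) e (isUnit_det_realDiagonal L dV hdV hdV0) (isUnit_det_realDiagonal L dW hdW hdW0)
  rw [← RingHom.mapMatrix_apply, ← RingHom.map_det]
  exact h.map _

/-- **(i) `dict β ∈ Skew_T(L)` for hermitian `β`**, `dict β := δ • (T⁻¹ * reindex ρ⁻¹ ρ⁻¹ β)`. [cite: Shimura1997, §18.1 (18.4)] [cite: KudlaRallis1994, §3] -/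
theorem dict_mem_skewMatrices (hdV0 : ∀ i, dV i ≠ 0) (hdW0 : ∀ i, dW i ≠ 0) (ρ : Fin n ≃ Fin 2) (β : Matrix (Fin 2) (Fin 2) L)
    (hβ : (β.map (IsCMField.complexConj L))ᵀ = β) :
    imagUnit L • (((gramR L e dV hdV dW hdW).map (algebraMap (Fp L) L))⁻¹ * Matrix.reindex ρ.symm ρ.symm β) ∈
      skewMatrices ((IsCMField.complexConj L : L ≃ₐ[Fp L] L) : L →+* L) ((gramR L e dV hdV dW hdW).map (algebraMap (Fp L) L)) := by
  refine smul_inv_mul_mem_skewMatrices _ (gramRL_isSymm L e dV hdV dW hdW) (map_gramRL_complexConj L e dV hdV dW hdW) (isUnit_det_gramRL L e dV hdV dW hdW hdV0 hdW0)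
    (complexConj_imagUnit L) _ ?_
  rw [transpose_map_reindex]
  exact congrArg (Matrix.reindex ρ.symm ρ.symm) hβ

/-- **(ii) `det (dict β) ≠ 0` for `det β ≠ 0`**. [cite: Shimura1997, §18.1 (18.4)] -/
theorem det_dict_ne_zero (hdV0 : ∀ i, dV i ≠ 0) (hdW0 : ∀ i, dW i ≠ 0) (ρ : Fin n ≃ Fin 2) (β : Matrix (Fin 2) (Fin 2) L) (hβ : β.det ≠ 0) :
    (imagUnit L • (((gramR L e dV hdV dW hdW).map (algebraMap (Fp L) L))⁻¹ * Matrix.reindex ρ.symm ρ.symm β)).det ≠ 0 :=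
  det_smul_inv_mul_ne_zero (isUnit_det_gramRL L e dV hdV dW hdW hdV0 hdW0) (imagUnit_ne_zero L) _ (by rwa [Matrix.det_reindex_self])

/-- **the inverse dictionary lands back**: `dict (reindex ρ ρ (δ⁻¹ • (T * S))) = S`. [cite: Shimura1997, §18.1 (18.4)] -/
theorem dict_reindex_smul_mul (hdV0 : ∀ i, dV i ≠ 0) (hdW0 : ∀ i, dW i ≠ 0) (ρ : Fin n ≃ Fin 2) (S : Matrix (Fin n) (Fin n) L) :
    imagUnit L • (((gramR L e dV hdV dW hdW).map (algebraMap (Fp L) L))⁻¹ *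
        Matrix.reindex ρ.symm ρ.symm (Matrix.reindex ρ ρ ((imagUnit L)⁻¹ • ((gramR L e dV hdV dW hdW).map (algebraMap (Fp L) L) * S)))) = S := by
  rw [← Matrix.reindex_symm, Equiv.symm_apply_apply]
  exact smul_inv_mul_smul_mul (isUnit_det_gramRL L e dV hdV dW hdW hdV0 hdW0) (imagUnit_ne_zero L) S

/-- **that `β` is hermitian** for `S ∈ Skew_T(L)`: `((reindex ρ ρ (δ⁻¹ • (T S)))^c)ᵀ = reindex ρ ρ (δ⁻¹ • (T S))`. [cite: Shimura1997, §18.1 (18.4)] -/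
theorem transpose_map_reindex_smul_mul (ρ : Fin n ≃ Fin 2) (S : Matrix (Fin n) (Fin n) L)
    (hS : S ∈ skewMatrices ((IsCMField.complexConj L : L ≃ₐ[Fp L] L) : L →+* L) ((gramR L e dV hdV dW hdW).map (algebraMap (Fp L) L))) :
    ((Matrix.reindex ρ ρ ((imagUnit L)⁻¹ • ((gramR L e dV hdV dW hdW).map (algebraMap (Fp L) L) * S))).map (IsCMField.complexConj L))ᵀ =
      Matrix.reindex ρ ρ ((imagUnit L)⁻¹ • ((gramR L e dV hdV dW hdW).map (algebraMap (Fp L) L) * S)) := by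
  have h := transpose_map_smul_mul_of_mem_skewMatrices ((IsCMField.complexConj L : L ≃ₐ[Fp L] L) : L →+* L) (gramRL_isSymm L e dV hdV dW hdW)
    (map_gramRL_complexConj L e dV hdV dW hdW) (complexConj_imagUnit L) S hS
  rw [show (IsCMField.complexConj L : L → L) = (((IsCMField.complexConj L : L ≃ₐ[Fp L] L) : L →+* L) : L → L) from rfl, transpose_map_reindex, h]

/-- **(iii) THE `hS` CLAUSE OF ★ `K2LiuFirstTermHolCutRows.exists_rows_of_mem` (:120–:121) VERBATIM at `dict := fun β => δ • (T⁻¹ * reindex ρ⁻¹ ρ⁻¹ β)`**: every non-zero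
`T`-skew `S` is `dict β` for a non-zero hermitian `β` (namely `β := reindex ρ ρ (δ⁻¹ • (T S))`). [cite: Shimura1997, §18.1 (18.4)] [cite: KudlaRallis1994, §3] [cite: MoeglinWaldspurger1995, I.2.6] -/
theorem hS_dict (hdV0 : ∀ i, dV i ≠ 0) (hdW0 : ∀ i, dW i ≠ 0) (ρ : Fin n ≃ Fin 2) :
    ∀ S : skewMatrices ((IsCMField.complexConj L : L ≃ₐ[Fp L] L) : L →+* L) ((gramR L e dV hdV dW hdW).map (algebraMap (Fp L) L)),
      S ≠ 0 → ∃ β : Matrix (Fin 2) (Fin 2) L, (β.map (IsCMField.complexConj L))ᵀ = β ∧ β ≠ 0 ∧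
        (fun β : Matrix (Fin 2) (Fin 2) L =>
            imagUnit L • (((gramR L e dV hdV dW hdW).map (algebraMap (Fp L) L))⁻¹ * Matrix.reindex ρ.symm ρ.symm β)) β =
          (S : Matrix (Fin n) (Fin n) L) := by
  intro S hS0
  refine ⟨Matrix.reindex ρ ρ ((imagUnit L)⁻¹ • ((gramR L e dV hdV dW hdW).map (algebraMap (Fp L) L) * (S : Matrix (Fin n) (Fin n) L))),
    transpose_map_reindex_smul_mul L e dV hdV dW hdW ρ _ S.2, fun hβ0 => hS0 ?_, dict_reindex_smul_mul L e dV hdV dW hdW hdV0 hdW0 ρ _⟩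
  -- `β = 0 ⇒ S = dict β = dict 0 = 0`
  have h := dict_reindex_smul_mul L e dV hdV dW hdW hdV0 hdW0 ρ (S : Matrix (Fin n) (Fin n) L)
  rw [hβ0, reindex_zero_sq, Matrix.mul_zero, smul_zero] at h
  exact Subtype.ext h.symm

/-- **(iv) `dict` is injective**: `dict β = 0 ↔ β = 0`. [folklore] -/
theorem dict_eq_zero_iff (hdV0 : ∀ i, dV i ≠ 0) (hdW0 : ∀ i, dW i ≠ 0) (ρ : Fin n ≃ Fin 2) (β : Matrix (Fin 2) (Fin 2) L) :
    imagUnit L • (((gramR L e dV hdV dW hdW).map (algebraMap (Fp L) L))⁻¹ * Matrix.reindex ρ.symm ρ.symm β) = 0 ↔ β = 0 := by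
  constructor
  · intro h
    have h' := eq_zero_of_smul_inv_mul_eq_zero (isUnit_det_gramRL L e dV hdV dW hdW hdV0 hdW0) (imagUnit_ne_zero L) _ h
    rw [← (Matrix.reindex ρ.symm ρ.symm).symm_apply_apply β, h', Matrix.reindex_symm, reindex_zero_sq]
  · rintro rfl
    rw [reindex_zero_sq, Matrix.mul_zero, smul_zero]

/-- `dict` is additive. [folklore] -/
theorem dict_add (ρ : Fin n ≃ Fin 2) (β β' : Matrix (Fin 2) (Fin 2) L) :
    imagUnit L • (((gramR L e dV hdV dW hdW).map (algebraMap (Fp L) L))⁻¹ * Matrix.reindex ρ.symm ρ.symm (β + β')) =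
      imagUnit L • (((gramR L e dV hdV dW hdW).map (algebraMap (Fp L) L))⁻¹ * Matrix.reindex ρ.symm ρ.symm β) +
        imagUnit L • (((gramR L e dV hdV dW hdW).map (algebraMap (Fp L) L))⁻¹ * Matrix.reindex ρ.symm ρ.symm β') := by
  rw [show Matrix.reindex ρ.symm ρ.symm (β + β') = Matrix.reindex ρ.symm ρ.symm β + Matrix.reindex ρ.symm ρ.symm β' from Matrix.ext fun _ _ => rfl,
    Matrix.mul_add, smul_add]

/-- `dict` is `L`-homogeneous. [folklore] -/
theorem dict_smul (ρ : Fin n ≃ Fin 2) (a : L) (β : Matrix (Fin 2) (Fin 2) L) :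
    imagUnit L • (((gramR L e dV hdV dW hdW).map (algebraMap (Fp L) L))⁻¹ * Matrix.reindex ρ.symm ρ.symm (a • β)) =
      a • (imagUnit L • (((gramR L e dV hdV dW hdW).map (algebraMap (Fp L) L))⁻¹ * Matrix.reindex ρ.symm ρ.symm β)) := by
  rw [show Matrix.reindex ρ.symm ρ.symm (a • β) = a • Matrix.reindex ρ.symm ρ.symm β from rfl, Matrix.mul_smul, smul_comm]


end Summit.HodgeConjecture.HodgeConjecture.Cruxes.HLiu418.K2LiuHermitianSkewDictionary

end
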